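import Literature.Geometry.Riemannian.GeodesicFlowAnalytic
import Literature.Geometry.Riemannian.CutLocusCharacterization
import Literature.Geometry.Riemannian.CutLocusBuchnerAssembly
import Literature.Geometry.Manifold.SubanalyticSetsProofs
import Literature.Geometry.Kaehler.FubiniStudy
import HarnessLib

/-!
# The tangent cut locus of a compact real-analytic Riemannian manifold is subanalytic

Support file of the programme towards the named fact
`Literature.Geometry.Riemannian.buchner1977_cutLocus_triangulable` (`CutLocus.lean`; M. A. Buchner,
*Simplicial structure of the real analytic cut locus*, Proc. AMS 64 (1977) 118–121). Buchner shows
(pp. 119–121) that the cut locus `C(p)` of a compact real-analytic Riemannian manifold is a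
subanalytic subset of `M`, by realising it inside Milnor's finite-dimensional approximation
`B_s ⊂ M × ⋯ × M` of the path space as `π{degenerate minimum of E} ∪ (π × π)(μ ×_M μ ∖ Δ)` and
invoking Hironaka's calculus of subanalytic sets — in particular the image theorem for relatively
compact subanalytic sets (p. 120, from Hironaka 1973), since `μ = B_t ∖ p₁(V)` is a complement of
an image. This file carries out the same programme with the tangent space `T_pM` and the analytic
exponential map `exp_p` (`GeodesicFlowAnalytic.lean`) in place of `B_s` and `π` — geodesics from
`p` are already an analytic finite-dimensional family — and isolates the single use of Hironaka's
image theorem: everything up to it is proved from the DEFINITION of subanalytic sets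
(Hironaka 1975, Def. 3.3, `IsSubanalytic`):

* `isSubanalytic_tangentCutLocus` — **the tangent cut locus `TCL(p) ⊆ T_pM` is a bounded
  subanalytic subset of `T_pM`**. With `q(v) = g_p(v, v)`, `μ = {v | γ_v|[0,1] minimizing}` and
  Buchner's characterisation `TCL(p) = {v ≠ 0} ∩ μ ∩ ({v conjugate} ∪ {∃ w ≠ v, w ∈ μ, exp w = exp v})`
  (p. 118; the tree's `mem_tangentCutLocus_iff`, `CutLocusCharacterization.lean`):
  `μ = {q < R₀²} ∖ pr₁{(v, w) | exp w = exp v, q w < q v}` is the complement of the image of a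
  bounded semi-analytic set (Hopf–Rinow), `{v conjugate} = {det d(exp_p)_v = 0}` is semi-analytic,
  and on `μ` the last set is `pr₁{(v, w) | w ≠ v, q w = q v, exp w = exp v}`, again an image of a
  bounded semi-analytic set — all admissible in Def. 3.3 without any theorem;
* `cutLocus_eq_image_tangentCutLocus` — `C(p) = exp_p(TCL(p))` (Lee 2018, p. 310; the tree's
  `cutLocus_eq_geodesicCutLocus_of_compactSpace`);
* `buchner1977_cutLocus_triangulable_of_hironaka` — hence **Buchner's theorem follows from three
  classical theorems of real-analytic geometry, each entering as an explicit hypothesis in the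
  tree's vocabulary**: (P) Hironaka's image theorem "the image of a bounded subanalytic subset of
  `ℝᵐ` under a real-analytic map `ℝᵐ → ℝᴺ` is subanalytic" (Hironaka 1975, Prop. II = Hironaka
  1973; the step Buchner takes on p. 120), (G) the existence of an injective real-analytic map of a
  compact analytic manifold into some `ℝᴺ` (Grauert–Morrey 1958), and (T) Hironaka's triangulation
  of compact subanalytic sets (1975, §3) — `ι(C(p)) = (ι ∘ exp_p)(TCL(p))`;
* `buchner1977_cutLocus_triangulable_of_manifold_hironaka` — the variant that stays in `M`, from the
  two inputs exactly as Buchner invokes them: his Lemma (p. 120, images of relatively compact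
  subanalytic sets under analytic maps into `M` are subanalytic in `M`, `IsManifoldSubanalytic`) and
  Hironaka's triangulation of closed subanalytic subsets of the compact analytic manifold `M`
  (p. 121).

Also: `isSemianalytic_setOf_expMap_eq` (the fibre square `{exp v = exp w} ⊆ T_pM × T_pM` is
semi-analytic), `isSemianalytic_setOf_isConjugateVector` (conjugate vectors form a semi-analytic
set), `analyticOnNhd_det` (the determinant is real-analytic on `E →L[ℝ] E`), and small additions to
the subanalytic calculus (`IsLocallyInBooleanClosure.of_locally`, `isSemianalytic_of_local_zeroSet`,
`IsSemianalytic.isSubanalytic_image_clm`); coercivity of `g_p` is the tree's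
`Literature.Geometry.Kaehler.exists_pos_mul_norm_sq_le` (`FubiniStudy.lean`). No definitions, no named
facts (D-0026).

## References

* [Buchner1977Simplicial] M. A. Buchner, Proc. AMS 64 (1977), pp. 118–121.
* [Hironaka1975] H. Hironaka, Triangulations of algebraic sets, PSPM 29 (1975), Def. 3.3, Prop. II,
  §3 Theorem.
* [LeeRiemannianManifolds2018] J. M. Lee, Introduction to Riemannian Manifolds (2018), Prop. 10.20,
  Prop. 10.32, p. 310, Cor. 6.21.
-/

noncomputable section

open Bundle Set Function Filter Metric
open scoped Manifold ContDiff Topology ENNReal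

/-! ## Additions to the subanalytic calculus -/

namespace Literature.Geometry.Manifold

section Generic

variable {X : Type*} [TopologicalSpace X] {gen : Set X → Set (Set X)}

/-- **Locality**: a set which agrees near every point with a member of a local Boolean class (with
antitone generating families) belongs to the class. [folklore] -/
theorem IsLocallyInBooleanClosure.of_locally (hgen : ∀ U V : Set X, V ⊆ U → gen U ⊆ gen V)
    {A : Set X} (h : ∀ x : X, ∃ U : Set X, IsOpen U ∧ x ∈ U ∧ ∃ A' : Set X,
      IsLocallyInBooleanClosure gen A' ∧ A ∩ U = A' ∩ U) :
    IsLocallyInBooleanClosure gen A := by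
  intro x
  obtain ⟨U, hU, hxU, A', hA', hAA'⟩ := h x
  obtain ⟨U', hU', hxU', S, hSf, hSg, B, hB, hA'B⟩ := hA' x
  refine ⟨U ∩ U', hU.inter hU', ⟨hxU, hxU'⟩, S, hSf, hSg.trans (hgen _ _ inter_subset_right), B, hB,
    ?_⟩
  calc A ∩ (U ∩ U') = (A ∩ U) ∩ U' := by rw [inter_assoc]
    _ = (A' ∩ U') ∩ U := by rw [hAA', inter_assoc, inter_comm U U', ← inter_assoc]
    _ = (B ∩ U') ∩ U := by rw [hA'B]
    _ = B ∩ (U ∩ U') := by rw [inter_assoc, inter_comm U' U]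

end Generic

section NormedSpace

variable {F : Type*} [NormedAddCommGroup F] [NormedSpace ℝ F]
  {F' : Type*} [NormedAddCommGroup F'] [NormedSpace ℝ F']

/-- **Local zero sets of finitely many functions analytic on a neighbourhood are semi-analytic**:
if every point has an open neighbourhood `U` and functions `f₁, …, f_k` real-analytic on `U` with
`Z ∩ U = {f₁ = ⋯ = f_k = 0} ∩ U`, then `Z` is semi-analytic (`{f = 0} = {0 ≤ f} ∩ {0 ≤ -f}`,
generators over `U`; Hironaka 1975, Def. 3.1 / Rem. 3.2). [cite: Hironaka1975, Def. 3.1 and Rem. 3.2] -/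
theorem isSemianalytic_of_local_zeroSet {Z : Set F}
    (h : ∀ z₀ : F, ∃ U : Set F, IsOpen U ∧ z₀ ∈ U ∧ ∃ (k : ℕ) (f : Fin k → F → ℝ),
      (∀ i, AnalyticOnNhd ℝ (f i) U) ∧ Z ∩ U = {z | ∀ i, f i z = 0} ∩ U) :
    IsSemianalytic Z := by
  classical
  intro z₀
  obtain ⟨U, hU, hz₀, k, f, hf, hZU⟩ := h z₀
  set S : Set (Set F) := (Finset.univ.image fun i : Fin k => {z : F | 0 ≤ f i z}) ∪
    (Finset.univ.image fun i : Fin k => {z : F | 0 ≤ -f i z}) with hS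
  refine ⟨U, hU, hz₀, S, ?_, ?_, ⋂ i ∈ (Finset.univ : Finset (Fin k)),
    ({z : F | 0 ≤ f i z} ∩ {z : F | 0 ≤ -f i z}), ?_, ?_⟩
  · exact (Finset.finite_toSet _).union (Finset.finite_toSet _)
  · intro s hs
    simp only [hS, Finset.coe_image, Finset.coe_univ, image_univ, mem_union,
      mem_range] at hs
    rcases hs with ⟨i, rfl⟩ | ⟨i, rfl⟩
    · exact ⟨f i, hf i, rfl⟩
    · exact ⟨fun z => -f i z, (hf i).neg, rfl⟩
  · refine BooleanSubalgebra.biInf_mem (Finset.finite_toSet _) fun i _ => ?_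
    refine BooleanSubalgebra.inf_mem (BooleanSubalgebra.subset_closure ?_)
      (BooleanSubalgebra.subset_closure ?_)
    · simp [hS]
    · simp [hS]
  · rw [hZU]
    congr 1
    ext z
    simp only [mem_setOf_eq, mem_iInter, Finset.mem_univ, forall_true_left, mem_inter_iff, neg_nonneg]
    exact forall_congr' fun i => ⟨fun h0 => by rw [h0]; exact ⟨le_rfl, le_rfl⟩,
      fun ⟨h1, h2⟩ => le_antisymm h2 h1⟩

/-- **Continuous linear images of bounded semi-analytic sets are subanalytic** (a generator of
Hironaka's Def. 3.3 after linear identification of the source with `ℝᵐ`). [cite: Hironaka1975, Def. 3.3] -/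
theorem IsSemianalytic.isSubanalytic_image_clm [FiniteDimensional ℝ F] {Z : Set F}
    (hZ : IsSemianalytic Z) (hZb : Bornology.IsBounded Z) (T : F →L[ℝ] F') :
    IsSubanalytic (T '' Z) := by
  set m : ℕ := Module.finrank ℝ F with hm
  have hdim : Module.finrank ℝ F = Module.finrank ℝ (Fin m → ℝ) := by
    rw [Module.finrank_fin_fun]
  set L : F ≃L[ℝ] (Fin m → ℝ) := ContinuousLinearEquiv.ofFinrankEq hdim with hL
  have himg : T '' Z = (fun y => T (L.symm y)) '' (L '' Z) := by
    rw [image_image]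
    congr 1
    funext z
    simp
  rw [himg]
  refine isSubanalytic_image (hZ.image_equiv L) ?_ fun y _ => ?_
  · exact ((hZb.isCompact_closure.image L.continuous).isBounded).subset
      (image_mono subset_closure)
  · exact (T.comp (L.symm : (Fin m → ℝ) →L[ℝ] F)).analyticAt y

/-- **The determinant is real-analytic on `F →L[ℝ] F`** (`F` finite-dimensional): in a basis it is
the Leibniz polynomial `∑_σ sign σ ∏ᵢ a_{σ(i) i}` in the matrix entries, which are continuous linear
functionals of the operator. [folklore] -/
theorem analyticOnNhd_det [FiniteDimensional ℝ F] :
    AnalyticOnNhd ℝ (fun T : F →L[ℝ] F => T.det) univ := by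
  classical
  set b := Module.finBasis ℝ F with hb
  -- the matrix entries are continuous linear functionals of the operator
  have hentry : ∀ i j : Fin (Module.finrank ℝ F),
      AnalyticOnNhd ℝ (fun T : F →L[ℝ] F => b.repr (T (b j)) i) univ := by
    intro i j T _
    have h1 : AnalyticAt ℝ (fun S : F →L[ℝ] F => S (b j)) T :=
      (ContinuousLinearMap.apply ℝ F (b j)).analyticAt T
    have h2 : AnalyticAt ℝ (fun v : F => b.repr v i) (T (b j)) :=
      ((b.coord i).toContinuousLinearMap).analyticAt _
    exact AnalyticAt.comp (f := fun S : F →L[ℝ] F => S (b j)) (x := T) h2 h1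
  have hprod : ∀ σ : Equiv.Perm (Fin (Module.finrank ℝ F)),
      AnalyticOnNhd ℝ (fun T : F →L[ℝ] F => ∏ i, b.repr (T (b i)) (σ i)) univ := by
    intro σ
    have h := Finset.analyticOnNhd_sum (Finset.univ : Finset (Fin (Module.finrank ℝ F)))
      (fun i _ => hentry (σ i) i)
    have h' := Finset.analyticOnNhd_prod (Finset.univ : Finset (Fin (Module.finrank ℝ F)))
      (fun i _ => hentry (σ i) i)
    rw [Finset.prod_fn] at h'
    clear h
    exact h'
  have hsum : AnalyticOnNhd ℝ (fun T : F →L[ℝ] F => ∑ σ : Equiv.Perm (Fin (Module.finrank ℝ F)),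
      ((Equiv.Perm.sign σ : ℤ) : ℝ) * ∏ i, b.repr (T (b i)) (σ i)) univ := by
    have h := Finset.analyticOnNhd_sum
      (f := fun (σ : Equiv.Perm (Fin (Module.finrank ℝ F))) (T : F →L[ℝ] F) =>
        ((Equiv.Perm.sign σ : ℤ) : ℝ) * ∏ i, b.repr (T (b i)) (σ i))
      (Finset.univ : Finset (Equiv.Perm (Fin (Module.finrank ℝ F))))
      (fun σ _ => (analyticOnNhd_const (v := ((Equiv.Perm.sign σ : ℤ) : ℝ))).mul (hprod σ))
    rw [Finset.sum_fn] at h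
    exact h
  have heq : (fun T : F →L[ℝ] F => T.det) = fun T =>
      ∑ σ : Equiv.Perm (Fin (Module.finrank ℝ F)),
        ((Equiv.Perm.sign σ : ℤ) : ℝ) * ∏ i, b.repr (T (b i)) (σ i) := by
    funext T
    rw [ContinuousLinearMap.det, ← LinearMap.det_toMatrix b, Matrix.det_apply]
    refine Finset.sum_congr rfl fun σ _ => ?_
    rw [Units.smul_def, zsmul_eq_mul]
    simp only [LinearMap.toMatrix_apply, ContinuousLinearMap.coe_coe]
  rw [heq]
  exact hsum

end NormedSpace

end Literature.Geometry.Manifold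

/-! ## Minimizing vectors on a complete manifold -/

namespace Literature.Geometry.Riemannian

open Literature.Geometry.Lorentzian
open Literature.Geometry.Lorentzian.PseudoRiemannianMetric
open Literature.Geometry.Manifold

section Minimizing

variable {E : Type*} [NormedAddCommGroup E] [NormedSpace ℝ E] {H : Type*} [TopologicalSpace H]
  {I : ModelWithCorners ℝ E H} {M : Type*} [TopologicalSpace M] [ChartedSpace H M]
  [IsManifold I ∞ M] {n : ℕ∞ω} [FiniteDimensional ℝ E] [CompleteSpace E] [T2Space M]
  [BoundarylessManifold I M]
  (g : PseudoRiemannianMetric I n E (TangentSpace I : M → Type _)) [g.HasLeviCivita]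
  [CovariantDerivative.ContMDiffCovariantDerivative g.leviCivita 1]

/-- On a complete manifold **`γ_v|[0,1]` is minimizing iff `d(p, exp_p v) = |v|_g`**
(`L(γ_v|[0,1]) = |v|_g`, `length_maximalGeodesic`; Lee 2018, p. 307). [cite: LeeRiemannianManifolds2018, pp. 307–308] -/
theorem isMinimizingUpTo_one_iff_edist [Fact (1 ≤ n)] (hg : g.IsRiemannian)
    (hc : IsGeodesicallyComplete g.leviCivita) (p : M) (v : TangentSpace I p) :
    IsMinimizingUpTo g hg p v 1 ↔
      g.edist hg p (expMap g.leviCivita p v) = ENNReal.ofReal (Real.sqrt (g.val p v v)) := by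
  have hdom := (maximalGeodesic_of_isGeodesicallyComplete hc p v).1
  have hlen : g.length hg (maximalGeodesic g.leviCivita p v) 0 1 =
      ENNReal.ofReal (Real.sqrt (g.val p v v)) := by
    rw [length_maximalGeodesic hg hc p v 0 1, sub_zero, one_mul]
  rw [expMap_eq_maximalGeodesic hc p v]
  constructor
  · rintro ⟨-, h⟩
    rw [← h, hlen]
  · intro h
    refine ⟨by rw [hdom]; exact subset_univ _, ?_⟩
    rw [hlen, h]

/-- **`d(p, exp_p w) ≤ |w|_g`** on a complete manifold (the geodesic `γ_w|[0,1]` has length `|w|_g`).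
[cite: LeeRiemannianManifolds2018, p. 307] -/
theorem edist_expMap_le_sqrt [Fact (1 ≤ n)] (hg : g.IsRiemannian)
    (hc : IsGeodesicallyComplete g.leviCivita) (p : M) (w : TangentSpace I p) :
    g.edist hg p (expMap g.leviCivita p w) ≤ ENNReal.ofReal (Real.sqrt (g.val p w w)) := by
  obtain ⟨-, -, h0, -⟩ := maximalGeodesic_of_isGeodesicallyComplete hc p w
  have h := edist_maximalGeodesic_le_length hg hc p w (zero_le_one (α := ℝ))
  rw [h0, length_maximalGeodesic hg hc p w 0 1, sub_zero, one_mul] at h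
  rwa [expMap_eq_maximalGeodesic hc p w]

/-- **A minimizing vector is not longer than any vector with the same exponential image**:
`γ_v|[0,1]` minimizing and `exp_p w = exp_p v` give `g_p(v,v) ≤ g_p(w,w)`
(`|v| = d(p, exp v) = d(p, exp w) ≤ |w|`). [cite: LeeRiemannianManifolds2018, p. 307] -/
theorem val_le_of_isMinimizingUpTo_one [Fact (1 ≤ n)] (hg : g.IsRiemannian)
    (hc : IsGeodesicallyComplete g.leviCivita) (p : M) {v w : TangentSpace I p}
    (hv : IsMinimizingUpTo g hg p v 1) (hvw : expMap g.leviCivita p w = expMap g.leviCivita p v) :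
    g.val p v v ≤ g.val p w w := by
  have h1 := (isMinimizingUpTo_one_iff_edist g hg hc p v).1 hv
  have h2 := edist_expMap_le_sqrt g hg hc p w
  rw [hvw, h1, ENNReal.ofReal_le_ofReal_iff (Real.sqrt_nonneg _)] at h2
  have h0w : 0 ≤ g.val p w w := by
    by_cases hw : w = 0
    · rw [hw]; simp
    · exact (hg p w hw).le
  exact (Real.sqrt_le_sqrt_iff h0w).1 h2

/-- **Hopf–Rinow converse**: on a complete connected manifold, if no vector with the same
exponential image is `g_p`-shorter than `v`, then `γ_v|[0,1]` is minimizing (a minimizing `w₀` with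
`exp_p w₀ = exp_p v` exists, Lee 2018, Cor. 6.21, and `|v| ≤ |w₀| = d(p, exp v) ≤ |v|`).
[cite: LeeRiemannianManifolds2018, Cor. 6.21] -/
theorem isMinimizingUpTo_one_of_forall_val_le [ConnectedSpace M] (hn : (∞ : ℕ∞ω) ≤ n)
    (hg : g.IsRiemannian) (hc : IsGeodesicallyComplete g.leviCivita) (p : M) {v : TangentSpace I p}
    (h : ∀ w : TangentSpace I p, expMap g.leviCivita p w = expMap g.leviCivita p v →
      g.val p v v ≤ g.val p w w) :
    IsMinimizingUpTo g hg p v 1 := by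
  haveI := fact_one_le_of_infty_le hn
  obtain ⟨w₀, hw₀, he⟩ := exists_isMinimizingUpTo_of_isGeodesicallyComplete g hn hg hc p
    (expMap g.leviCivita p v)
  have he' : expMap g.leviCivita p w₀ = expMap g.leviCivita p v := he
  have h1 := (isMinimizingUpTo_one_iff_edist g hg hc p w₀).1 hw₀
  rw [he'] at h1
  have h2 := edist_expMap_le_sqrt g hg hc p v
  have h3 : g.val p v v ≤ g.val p w₀ w₀ := h w₀ he'
  have h0v : 0 ≤ g.val p v v := by
    by_cases hv : v = 0
    · rw [hv]; simp
    · exact (hg p v hv).le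
  rw [isMinimizingUpTo_one_iff_edist g hg hc p v]
  refine le_antisymm h2 ?_
  rw [h1]
  exact ENNReal.ofReal_le_ofReal (Real.sqrt_le_sqrt h3)

/-- **Among vectors with the exponential image of a minimizing `v`, the minimizing ones are those
of the same `g_p`-length.** [cite: LeeRiemannianManifolds2018, p. 307] -/
theorem isMinimizingUpTo_one_iff_val_eq [Fact (1 ≤ n)] (hg : g.IsRiemannian)
    (hc : IsGeodesicallyComplete g.leviCivita) (p : M) {v w : TangentSpace I p}
    (hv : IsMinimizingUpTo g hg p v 1) (hvw : expMap g.leviCivita p w = expMap g.leviCivita p v) :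
    IsMinimizingUpTo g hg p w 1 ↔ g.val p w w = g.val p v v := by
  have h1 := (isMinimizingUpTo_one_iff_edist g hg hc p v).1 hv
  have h0v : 0 ≤ g.val p v v := by
    by_cases hv0 : v = 0
    · rw [hv0]; simp
    · exact (hg p v hv0).le
  have h0w : 0 ≤ g.val p w w := by
    by_cases hw0 : w = 0
    · rw [hw0]; simp
    · exact (hg p w hw0).le
  rw [isMinimizingUpTo_one_iff_edist g hg hc p w, hvw, h1]
  constructor
  · intro h
    have h' := ENNReal.ofReal_eq_ofReal_iff (Real.sqrt_nonneg _) (Real.sqrt_nonneg _) |>.1 h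
    have h'' := congrArg (fun t : ℝ => t ^ 2) h'
    simp only [Real.sq_sqrt h0v, Real.sq_sqrt h0w] at h''
    exact h''.symm
  · intro h
    rw [h]

end Minimizing

/-! ## The fibre square of `exp_p` and the conjugate vectors are semi-analytic -/

section Analytic

variable {E : Type*} [NormedAddCommGroup E] [NormedSpace ℝ E] {H : Type*} [TopologicalSpace H]
  {I : ModelWithCorners ℝ E H} {M : Type*} [TopologicalSpace M] [ChartedSpace H M]
  [IsManifold I ω M] [FiniteDimensional ℝ E] [CompleteSpace E] [T2Space M]
  [BoundarylessManifold I M]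

omit [FiniteDimensional ℝ E] [CompleteSpace E] [T2Space M] [BoundarylessManifold I M] in
/-- An analytic map into a real-analytic manifold, read in an extended chart, is real-analytic at
every point mapped into the chart domain. [folklore] -/
theorem analyticAt_extChartAt_comp {F : Type*} [NormedAddCommGroup F] [NormedSpace ℝ F]
    {f : F → M} (hf : ContMDiff 𝓘(ℝ, F) I ω f) (x₀ : M) {z : F}
    (hz : f z ∈ (extChartAt I x₀).source) :
    AnalyticAt ℝ (fun z => extChartAt I x₀ (f z)) z := by
  set U : Set F := f ⁻¹' (extChartAt I x₀).source with hU
  have hUo : IsOpen U := (isOpen_extChartAt_source x₀).preimage hf.continuous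
  have h1 : ContMDiffOn 𝓘(ℝ, F) 𝓘(ℝ, E) ω (fun z => extChartAt I x₀ (f z)) U :=
    (contMDiffOn_extChartAt (x := x₀)).comp hf.contMDiffOn fun z hz => by
      have h : f z ∈ (extChartAt I x₀).source := hz
      rwa [extChartAt_source] at h
  have h2 : ContDiffOn ℝ ω (fun z => extChartAt I x₀ (f z)) U := contMDiffOn_iff_contDiffOn.1 h1
  exact ((h2 z hz).contDiffAt (hUo.mem_nhds hz)).analyticAt

variable (g : PseudoRiemannianMetric I ω E (TangentSpace I : M → Type _)) [g.HasLeviCivita]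
  [CovariantDerivative.ContMDiffCovariantDerivative g.leviCivita 1]

/-- **The fibre square `{(v, w) | exp_p v = exp_p w} ⊆ T_pM × T_pM` of the analytic exponential map
is semi-analytic** (complete real-analytic metric): near a pair with `exp_p v₀ ≠ exp_p w₀` it is
empty (Hausdorff), near a pair with `exp_p v₀ = exp_p w₀ = x₀` it is the zero set of the analytic
map `(v, w) ↦ φ(exp_p v) - φ(exp_p w)`, `φ` a chart at `x₀`. (Buchner's fibred products
`B_s ×_M B_s`, p. 119, for the family of geodesics from `p`.) [cite: Buchner1977Simplicial, p. 119] -/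
theorem isSemianalytic_setOf_expMap_eq (hc : IsGeodesicallyComplete g.leviCivita) (p : M) :
    IsSemianalytic {z : E × E | expMap g.leviCivita p (show TangentSpace I p from z.1) =
      expMap g.leviCivita p (show TangentSpace I p from z.2)} := by
  classical
  set ex : E → M := fun v => expMap g.leviCivita p (show TangentSpace I p from v) with hex_def
  have hex : ContMDiff 𝓘(ℝ, E) I ω ex := contMDiff_riemannianExpMap_omega g hc p
  have hex1 : ContMDiff 𝓘(ℝ, E × E) I ω (fun z : E × E => ex z.1) :=
    hex.comp (contMDiff_iff_contDiff.2 (contDiff_fst : ContDiff ℝ ω (Prod.fst : E × E → E)))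
  have hex2 : ContMDiff 𝓘(ℝ, E × E) I ω (fun z : E × E => ex z.2) :=
    hex.comp (contMDiff_iff_contDiff.2 (contDiff_snd : ContDiff ℝ ω (Prod.snd : E × E → E)))
  refine isSemianalytic_of_local_zeroSet fun z₀ => ?_
  by_cases hne : ex z₀.1 ≠ ex z₀.2
  · -- empty germ
    obtain ⟨O₁, O₂, hO₁, hO₂, h₁, h₂, hdisj⟩ := t2_separation hne
    refine ⟨{z | ex z.1 ∈ O₁ ∧ ex z.2 ∈ O₂}, ?_, ⟨h₁, h₂⟩, 1, fun _ _ => 1,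
      fun _ => analyticOnNhd_const, ?_⟩
    · exact (hO₁.preimage hex1.continuous).inter (hO₂.preimage hex2.continuous)
    · ext z
      constructor
      · rintro ⟨hz, h1', h2'⟩
        have e : ex z.1 = ex z.2 := hz
        exact (Set.disjoint_iff.1 hdisj ⟨e ▸ h1', h2'⟩).elim
      · rintro ⟨hz, -⟩
        exact (one_ne_zero (hz 0)).elim
  · push Not at hne
    set x₀ := ex z₀.1 with hx₀
    set φ := extChartAt I x₀ with hφ
    set b := Module.finBasis ℝ E with hb
    set U : Set (E × E) := {z | ex z.1 ∈ φ.source ∧ ex z.2 ∈ φ.source} with hU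
    have hUo : IsOpen U := ((isOpen_extChartAt_source x₀).preimage hex1.continuous).inter
      ((isOpen_extChartAt_source x₀).preimage hex2.continuous)
    have hz₀ : z₀ ∈ U := ⟨mem_extChartAt_source x₀, by
      show ex z₀.2 ∈ φ.source
      rw [← hne]; exact mem_extChartAt_source x₀⟩
    refine ⟨U, hUo, hz₀, Module.finrank ℝ E,
      fun i z => b.repr (φ (ex z.1) - φ (ex z.2)) i, fun i z hz => ?_, ?_⟩
    · have ha1 : AnalyticAt ℝ (fun z : E × E => φ (ex z.1)) z :=
        analyticAt_extChartAt_comp hex1 x₀ hz.1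
      have ha2 : AnalyticAt ℝ (fun z : E × E => φ (ex z.2)) z :=
        analyticAt_extChartAt_comp hex2 x₀ hz.2
      exact ((b.coord i).toContinuousLinearMap).analyticAt _ |>.comp (ha1.sub ha2)
    · ext z
      simp only [mem_inter_iff, mem_setOf_eq]
      constructor
      · rintro ⟨hz, hzU⟩
        refine ⟨fun i => ?_, hzU⟩
        have e : ex z.1 = ex z.2 := hz
        have h : φ (ex z.1) - φ (ex z.2) = 0 := by rw [e, sub_self]
        rw [h, map_zero, Finsupp.zero_apply]
      · rintro ⟨hz, hzU⟩
        refine ⟨?_, hzU⟩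
        have h : φ (ex z.1) - φ (ex z.2) = 0 := by
          rw [b.ext_elem_iff]
          intro i
          rw [hz i, map_zero, Finsupp.zero_apply]
        exact φ.injOn hzU.1 hzU.2 (sub_eq_zero.1 h)

/-- **The conjugate vectors of `exp_p` form a semi-analytic subset of `T_pM`** (complete
real-analytic metric): near `v₀`, with `φ` a chart at `exp_p v₀`, `v` is conjugate iff
`det d(φ ∘ exp_p)_v = 0` (Lee 2018, Prop. 10.20: conjugate = critical), an analytic equation.
(Buchner's rank condition on the Hessian, p. 120, for the family of geodesics from `p`.)
[cite: Buchner1977Simplicial, p. 120] -/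
theorem isSemianalytic_setOf_isConjugateVector (hc : IsGeodesicallyComplete g.leviCivita) (p : M) :
    IsSemianalytic {v : E | IsConjugateVector g p (show TangentSpace I p from v)} := by
  set ex : E → M := fun v => expMap g.leviCivita p (show TangentSpace I p from v) with hex_def
  have hex : ContMDiff 𝓘(ℝ, E) I ω ex := contMDiff_riemannianExpMap_omega g hc p
  have hdom : ∀ v : E, (show TangentSpace I p from v) ∈ riemannianExpDomain g p := fun v => by
    show (show TangentSpace I p from v) ∈ expDomain g.leviCivita p
    rw [expDomain_eq_univ (cov := g.leviCivita) hc p]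
    exact mem_univ _
  refine isSemianalytic_of_local_zeroSet fun v₀ => ?_
  set x₀ := ex v₀ with hx₀
  set φ := extChartAt I x₀ with hφ
  set U : Set E := ex ⁻¹' φ.source with hU
  have hUo : IsOpen U := (isOpen_extChartAt_source x₀).preimage hex.continuous
  have hv₀ : v₀ ∈ U := mem_extChartAt_source x₀
  set F : E → E := fun v => φ (ex v) with hF
  have hFa : AnalyticOnNhd ℝ F U := fun v hv => analyticAt_extChartAt_comp hex x₀ hv
  have hdFa : AnalyticOnNhd ℝ (fderiv ℝ F) U := hFa.fderiv_of_isOpen hUo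
  -- on `U`: conjugate iff `det (fderiv F v) = 0`
  have key : ∀ v ∈ U, (IsConjugateVector g p (show TangentSpace I p from v) ↔
      (fderiv ℝ F v).det = 0) := by
    intro v hv
    have hvU' : ex v ∈ φ.source := hv
    have hsrc : ex v ∈ (chartAt H x₀).source := by rwa [← extChartAt_source I]
    have hφd : MDifferentiableAt I 𝓘(ℝ, E) φ (ex v) :=
      (contMDiffAt_extChartAt' (n := ω) hsrc).mdifferentiableAt (by simp)
    have hexd : MDifferentiableAt 𝓘(ℝ, E) I ex v := hex.mdifferentiableAt (by simp)
    have hcomp : fderiv ℝ F v =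
        (mfderiv I 𝓘(ℝ, E) φ (ex v)).comp (mfderiv 𝓘(ℝ, E) I ex v) := by
      rw [← mfderiv_eq_fderiv]
      exact mfderiv_comp v hφd hexd
    have hA := (isInvertible_mfderiv_extChartAt (I := I) hvU').injective
    have hiff : Injective (fderiv ℝ F v) ↔ Injective (mfderiv 𝓘(ℝ, E) I ex v) := by
      rw [hcomp]
      exact hA.of_comp_iff _
    -- `det = 0 ↔ ¬ injective` (the tree's `det_eq_zero_iff_not_injective`, Morse height functions)
    have hdet : (fderiv ℝ F v).det = 0 ↔ ¬ Injective (fderiv ℝ F v) := by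
      rw [ContinuousLinearMap.det, LinearMap.det_eq_zero_iff_ker_ne_bot, Ne, LinearMap.ker_eq_bot]
      rfl
    rw [hdet]
    constructor
    · intro h hinj
      exact h.2 (hiff.1 hinj)
    · intro h
      exact ⟨hdom v, fun hinj => h (hiff.2 hinj)⟩
  refine ⟨U, hUo, hv₀, 1, fun _ v => (fderiv ℝ F v).det, fun _ v hv => ?_, ?_⟩
  · exact (analyticOnNhd_det _ (mem_univ _)).comp (hdFa v hv)
  · ext v
    simp only [mem_inter_iff, mem_setOf_eq, forall_const]
    constructor
    · rintro ⟨h, hvU⟩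
      exact ⟨(key v hvU).1 h, hvU⟩
    · rintro ⟨h, hvU⟩
      exact ⟨(key v hvU).2 h, hvU⟩

end Analytic

/-! ## The tangent cut locus is subanalytic -/

section TangentCutLocus

variable {E : Type*} [NormedAddCommGroup E] [NormedSpace ℝ E] {H : Type*} [TopologicalSpace H]
  {I : ModelWithCorners ℝ E H} {M : Type*} [TopologicalSpace M] [ChartedSpace H M]
  [IsManifold I ω M] [FiniteDimensional ℝ E] [CompleteSpace E] [T2Space M]
  [BoundarylessManifold I M] [CompactSpace M] [ConnectedSpace M]
  (g : PseudoRiemannianMetric I ω E (TangentSpace I : M → Type _)) [g.HasLeviCivita]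
  [CovariantDerivative.ContMDiffCovariantDerivative g.leviCivita 1]

omit [CompleteSpace E] [BoundarylessManifold I M]
  [g.HasLeviCivita] [CovariantDerivative.ContMDiffCovariantDerivative g.leviCivita 1] in
/-- On a compact connected manifold all distances from `p` are bounded by some `R₀`. [folklore] -/
theorem exists_edist_lt (hg : g.IsRiemannian) (p : M) :
    ∃ R₀ > (0 : ℝ), ∀ x : M, g.edist hg p x < ENNReal.ofReal R₀ := by
  have hcont : Continuous fun y : M => g.edist hg p y :=
    (PseudoRiemannianMetric.continuous_edist hg).comp (Continuous.prodMk_right p)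
  obtain ⟨x₁, -, hx₁⟩ := isCompact_univ.exists_isMaxOn univ_nonempty hcont.continuousOn
  have hmax : ∀ x, g.edist hg p x ≤ g.edist hg p x₁ := fun x => isMaxOn_iff.1 hx₁ x (mem_univ x)
  have hfin : g.edist hg p x₁ ≠ ⊤ := edist_ne_top hg p x₁
  set D : ℝ := (g.edist hg p x₁).toReal with hD
  have hD0 : 0 ≤ D := ENNReal.toReal_nonneg
  have hDeq : g.edist hg p x₁ = ENNReal.ofReal D := (ENNReal.ofReal_toReal hfin).symm
  refine ⟨D + 1, by linarith, fun x => (hmax x).trans_lt ?_⟩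
  rw [hDeq]
  exact ENNReal.ofReal_lt_ofReal_iff'.2 ⟨by linarith, by linarith⟩

omit [CompleteSpace E] [T2Space M] [BoundarylessManifold I M] [CompactSpace M]
  [ConnectedSpace M] [g.HasLeviCivita]
  [CovariantDerivative.ContMDiffCovariantDerivative g.leviCivita 1] in
/-- Sublevel sets `{v | g_p(v,v) < r}` of the metric at `p` are bounded in the model space
(coercivity of the positive definite form `g_p`, the tree's
`Literature.Geometry.Kaehler.exists_pos_mul_norm_sq_le`). [folklore] -/
theorem isBounded_setOf_val_lt (hg : g.IsRiemannian) (p : M) {R₀ : ℝ} (hR₀ : 0 < R₀) :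
    Bornology.IsBounded {v : E | g.val p (show TangentSpace I p from v)
      (show TangentSpace I p from v) < R₀ ^ 2} := by
  have hqpos : ∀ v : E, v ≠ 0 → 0 < (show E →L[ℝ] E →L[ℝ] ℝ from g.val p) v v :=
    fun v hv => hg p (show TangentSpace I p from v) hv
  obtain ⟨c, hcpos, hcq⟩ :=
    Literature.Geometry.Kaehler.exists_pos_mul_norm_sq_le (show E →L[ℝ] E →L[ℝ] ℝ from g.val p) hqpos
  rw [Metric.isBounded_iff_subset_closedBall (0 : E)]
  refine ⟨R₀ / Real.sqrt c, fun v hv => ?_⟩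
  rw [mem_closedBall, dist_zero_right]
  have hv' : c * ‖v‖ ^ 2 < R₀ ^ 2 := (hcq v).trans_lt hv
  have hsc : 0 < Real.sqrt c := Real.sqrt_pos.2 hcpos
  rw [le_div_iff₀ hsc]
  have h1 : (‖v‖ * Real.sqrt c) ^ 2 < R₀ ^ 2 := by
    rw [mul_pow, Real.sq_sqrt hcpos.le, mul_comm]; exact hv'
  have h2 : |‖v‖ * Real.sqrt c| < |R₀| := sq_lt_sq.1 h1
  rw [abs_of_nonneg (by positivity), abs_of_pos hR₀] at h2
  exact h2.le

omit [CompactSpace M] [ConnectedSpace M] in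
/-- A minimizing vector is `g_p`-shorter than any bound on the distances from `p`:
`γ_v|[0,1]` minimizing and `d(p, ·) < R₀` give `g_p(v,v) < R₀²`. [cite: LeeRiemannianManifolds2018, p. 307] -/
theorem val_lt_sq_of_isMinimizingUpTo_one (hg : g.IsRiemannian)
    (hc : IsGeodesicallyComplete g.leviCivita) (p : M) {R₀ : ℝ} (hR₀ : 0 < R₀)
    (hR : ∀ x : M, g.edist hg p x < ENNReal.ofReal R₀) {v : TangentSpace I p}
    (hv : IsMinimizingUpTo g hg p v 1) : g.val p v v < R₀ ^ 2 := by
  haveI : Fact (1 ≤ (ω : ℕ∞ω)) := ⟨le_top⟩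
  have h1 := (isMinimizingUpTo_one_iff_edist g hg hc p v).1 hv
  have h2 := hR (expMap g.leviCivita p v)
  rw [h1, ENNReal.ofReal_lt_ofReal_iff hR₀] at h2
  exact (Real.sqrt_lt' hR₀).1 h2

/-- **The tangent cut locus of a point of a compact real-analytic Riemannian manifold is a
subanalytic subset of `T_pM`** — proved from Hironaka's Def. 3.3 alone. With `q(v) = g_p(v,v)`,
`μ = {v | γ_v|[0,1] minimizing}`, a bound `d(p, ·) < R₀` and the semi-analytic sets
`Z₁ = {(v,w) | q v < R₀², exp v = exp w, q w < q v}`, `Z₂ = {(v,w) | q v < R₀², w ≠ v, q w = q v,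
exp v = exp w}` (bounded, by coercivity of `q`): `μ = {q < R₀²} ∖ pr₁ Z₁` (Hopf–Rinow:
`isMinimizingUpTo_one_of_forall_val_le`, `val_le_of_isMinimizingUpTo_one`) and
`TCL(p) = {v ≠ 0} ∩ μ ∩ ({conjugate} ∪ pr₁ Z₂)` (Buchner's characterisation, the tree's
`mem_tangentCutLocus_iff`, with `isMinimizingUpTo_one_iff_val_eq`); `{conjugate}` is semi-analytic
(`isSemianalytic_setOf_isConjugateVector`) and `pr₁ Zᵢ` are images of bounded semi-analytic sets
under a linear map (`IsSemianalytic.isSubanalytic_image_clm`). This is the part of Buchner 1977,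
pp. 119–121, that precedes the image theorem, for the family `exp_p` in place of Milnor's `B_s`.
[cite: Buchner1977Simplicial, pp. 119–121] -/
theorem isSubanalytic_tangentCutLocus (hg : g.IsRiemannian) (p : M) :
    IsSubanalytic {v : E | (show TangentSpace I p from v) ∈ tangentCutLocus g hg p} := by
  classical
  haveI : Fact (1 ≤ (ω : ℕ∞ω)) := ⟨le_top⟩
  have hn : (∞ : ℕ∞ω) ≤ ω := le_top
  have hc : IsGeodesicallyComplete g.leviCivita :=
    g.isGeodesicallyComplete_of_compactSpace (le_top : (2 : ℕ∞ω) ≤ ω) hg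
  set ex : E → M := fun v => expMap g.leviCivita p (show TangentSpace I p from v) with hex_def
  set q : E → ℝ := fun v => g.val p (show TangentSpace I p from v) (show TangentSpace I p from v)
    with hq_def
  set Mn : E → Prop := fun v => IsMinimizingUpTo g hg p (show TangentSpace I p from v) 1 with hMn
  -- analyticity of `q`
  have hqa : AnalyticOnNhd ℝ q univ := fun v _ =>
    AnalyticAt.comp (g := fun x : E × E => (show E →L[ℝ] E →L[ℝ] ℝ from g.val p) x.1 x.2)
      (f := ⇑((ContinuousLinearMap.id ℝ E).prod (ContinuousLinearMap.id ℝ E))) (x := v)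
      ((show E →L[ℝ] E →L[ℝ] ℝ from g.val p).analyticAt_bilinear (v, v))
      (((ContinuousLinearMap.id ℝ E).prod (ContinuousLinearMap.id ℝ E)).analyticAt v)
  have hq1 : AnalyticOnNhd ℝ (fun z : E × E => q z.1) univ := fun z _ =>
    (hqa z.1 (mem_univ _)).comp ((ContinuousLinearMap.fst ℝ E E).analyticAt z)
  have hq2 : AnalyticOnNhd ℝ (fun z : E × E => q z.2) univ := fun z _ =>
    (hqa z.2 (mem_univ _)).comp ((ContinuousLinearMap.snd ℝ E E).analyticAt z)
  -- positivity of `q`, the bound `R₀`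
  have hq00 : q 0 = 0 := by
    show g.val p (0 : TangentSpace I p) (0 : TangentSpace I p) = 0
    simp
  have hqpos : ∀ v : E, v ≠ 0 → 0 < q v := fun v hv => hg p (show TangentSpace I p from v) hv
  have hqz : ∀ v : E, q v = 0 ↔ v = 0 := fun v =>
    ⟨fun h => by_contra fun hv => (hqpos v hv).ne' h, fun h => by rw [h]; exact hq00⟩
  obtain ⟨R₀, hR₀, hR⟩ := exists_edist_lt g hg p
  have hbddE : Bornology.IsBounded {v : E | q v < R₀ ^ 2} := isBounded_setOf_val_lt g hg p hR₀
  have hMq : ∀ v : E, Mn v → q v < R₀ ^ 2 := fun v hv =>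
    val_lt_sq_of_isMinimizingUpTo_one g hg hc p hR₀ hR hv
  -- the sets
  set A₀ : Set E := {v | q v < R₀ ^ 2} with hA₀
  set Zx : Set (E × E) := {z | ex z.1 = ex z.2} with hZx
  set Z₁ : Set (E × E) := {z | q z.1 < R₀ ^ 2} ∩ Zx ∩ {z | q z.2 < q z.1} with hZ₁
  set Z₂ : Set (E × E) := {z | q z.1 < R₀ ^ 2} ∩ {z | z.1 = z.2}ᶜ ∩ {z | q z.2 = q z.1} ∩ Zx
    with hZ₂
  set P₁ : Set E := (ContinuousLinearMap.fst ℝ E E) '' Z₁ with hP₁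
  set P₂ : Set E := (ContinuousLinearMap.fst ℝ E E) '' Z₂ with hP₂
  set C : Set E := {v | IsConjugateVector g p (show TangentSpace I p from v)} with hC
  set N₀ : Set E := {v : E | q v = 0}ᶜ with hN₀
  -- semi-analyticity
  have hA₀s : IsSemianalytic A₀ := isSemianalytic_setOf_lt hqa analyticOnNhd_const
  have hZxs : IsSemianalytic Zx := isSemianalytic_setOf_expMap_eq g hc p
  have hdiag : IsSemianalytic {z : E × E | z.1 = z.2} := by
    have h : IsSemianalytic {v : E | q v = 0} := isSemianalytic_setOf_eq_zero hqa
    have h' : IsSemianalytic ((fun z : E × E => z.1 - z.2) ⁻¹' {v : E | q v = 0}) :=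
      h.preimage fun z _ =>
        ((ContinuousLinearMap.fst ℝ E E) - (ContinuousLinearMap.snd ℝ E E)).analyticAt z
    have heq : {z : E × E | z.1 = z.2} = (fun z : E × E => z.1 - z.2) ⁻¹' {v : E | q v = 0} := by
      ext z
      rw [mem_setOf_eq, mem_preimage, mem_setOf_eq, hqz, sub_eq_zero]
    rw [heq]
    exact h'
  have hZ₁s : IsSemianalytic Z₁ :=
    ((isSemianalytic_setOf_lt hq1 analyticOnNhd_const).inter hZxs).inter
      (isSemianalytic_setOf_lt hq2 hq1)
  have hZ₂s : IsSemianalytic Z₂ :=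
    (((isSemianalytic_setOf_lt hq1 analyticOnNhd_const).inter hdiag.compl).inter
      (isSemianalytic_setOf_eq hq2 hq1)).inter hZxs
  have hCs : IsSemianalytic C := isSemianalytic_setOf_isConjugateVector g hc p
  have hN₀s : IsSemianalytic N₀ := (isSemianalytic_setOf_eq_zero hqa).compl
  -- boundedness of `Z₁`, `Z₂`, subanalyticity of `P₁`, `P₂`
  have hbdd2 : Bornology.IsBounded ({v : E | q v < R₀ ^ 2} ×ˢ {v : E | q v < R₀ ^ 2}) :=
    hbddE.prod hbddE
  have hZ₁b : Bornology.IsBounded Z₁ := hbdd2.subset fun z hz => by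
    refine ⟨hz.1.1, ?_⟩
    show q z.2 < R₀ ^ 2
    exact lt_trans hz.2 hz.1.1
  have hZ₂b : Bornology.IsBounded Z₂ := hbdd2.subset fun z hz => by
    refine ⟨hz.1.1.1, ?_⟩
    show q z.2 < R₀ ^ 2
    rw [show q z.2 = q z.1 from hz.1.2]
    exact hz.1.1.1
  have hP₁s : IsSubanalytic P₁ := hZ₁s.isSubanalytic_image_clm hZ₁b _
  have hP₂s : IsSubanalytic P₂ := hZ₂s.isSubanalytic_image_clm hZ₂b _
  -- `μ = A₀ \ P₁`
  have hM : ∀ v : E, Mn v ↔ v ∈ A₀ ∧ v ∉ P₁ := by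
    intro v
    constructor
    · intro hv
      refine ⟨hMq v hv, ?_⟩
      rintro ⟨z, hz, hzv⟩
      have hzv' : z.1 = v := hzv
      obtain ⟨⟨-, hzx⟩, hlt⟩ := hz
      have hzx' : ex z.2 = ex v := by rw [← hzv']; exact (hzx : ex z.1 = ex z.2).symm
      have hle := val_le_of_isMinimizingUpTo_one g hg hc p hv
        (w := show TangentSpace I p from z.2) hzx'
      rw [← hzv'] at hle
      exact absurd (hlt : q z.2 < q z.1) (not_lt.2 hle)
    · rintro ⟨hA, hP⟩
      refine isMinimizingUpTo_one_of_forall_val_le g hn hg hc p fun w hw => ?_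
      by_contra hlt
      push Not at hlt
      exact hP ⟨(v, show E from w), ⟨⟨hA, (hw : ex (show E from w) = ex v).symm⟩, hlt⟩, rfl⟩
  -- on `μ`: second minimizer iff `v ∈ P₂`
  have hN : ∀ v : E, Mn v → ((∃ w : TangentSpace I p, w ≠ (show TangentSpace I p from v) ∧
      IsMinimizingUpTo g hg p w 1 ∧ riemannianExpMap g p w =
        riemannianExpMap g p (show TangentSpace I p from v)) ↔ v ∈ P₂) := by
    intro v hv
    constructor
    · rintro ⟨w, hwv, hw, he⟩
      have he' : ex (show E from w) = ex v := he
      refine ⟨(v, show E from w), ⟨⟨⟨hMq v hv, fun h => hwv ?_⟩, ?_⟩, he'.symm⟩, rfl⟩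
      · exact (h : v = (show E from w)).symm
      · show q (show E from w) = q v
        exact (isMinimizingUpTo_one_iff_val_eq g hg hc p hv he').1 hw
    · rintro ⟨z, ⟨⟨⟨-, hne⟩, hqq⟩, hzx⟩, hzv⟩
      have hzv' : z.1 = v := hzv
      have he' : ex z.2 = ex v := by rw [← hzv']; exact (hzx : ex z.1 = ex z.2).symm
      refine ⟨show TangentSpace I p from z.2, fun h => hne ?_, ?_, he'⟩
      · show z.1 = z.2
        rw [hzv']
        exact (h : z.2 = v).symm
      · exact (isMinimizingUpTo_one_iff_val_eq g hg hc p hv he').2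
          (by rw [← hzv']; exact (hqq : q z.2 = q z.1))
  -- the identity `TCL = N₀ ∩ (A₀ \ P₁) ∩ (C ∪ P₂)`
  have hTCL : {v : E | (show TangentSpace I p from v) ∈ tangentCutLocus g hg p} =
      N₀ ∩ (A₀ \ P₁) ∩ (C ∪ P₂) := by
    ext v
    rw [mem_setOf_eq, mem_tangentCutLocus_iff hn hg hc]
    simp only [mem_inter_iff, Set.mem_sdiff, mem_union, hN₀, mem_compl_iff, mem_setOf_eq]
    constructor
    · rintro ⟨hv0, hmin, hor⟩
      have hv0' : ¬ q v = 0 := fun h => hv0 ((hqz v).1 h)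
      refine ⟨⟨hv0', (hM v).1 hmin⟩, ?_⟩
      rcases hor with hconj | hex2
      · exact Or.inl hconj
      · exact Or.inr ((hN v hmin).1 hex2)
    · rintro ⟨⟨hv0, hAP⟩, hor⟩
      have hmin : Mn v := (hM v).2 hAP
      refine ⟨fun h => hv0 ((hqz v).2 h), hmin, ?_⟩
      rcases hor with hconj | hP
      · exact Or.inl hconj
      · exact Or.inr ((hN v hmin).2 hP)
  rw [hTCL]
  exact (hN₀s.isSubanalytic.inter (hA₀s.isSubanalytic.diff hP₁s)).inter
    (hCs.isSubanalytic.union hP₂s)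

/-- The tangent cut locus of a point of a compact Riemannian manifold is bounded in `T_pM`
(`|v|_g = d(p, exp_p v)` on it). [cite: LeeRiemannianManifolds2018, p. 310] -/
theorem isBounded_tangentCutLocus (hg : g.IsRiemannian) (p : M) :
    Bornology.IsBounded {v : E | (show TangentSpace I p from v) ∈ tangentCutLocus g hg p} := by
  haveI : Fact (1 ≤ (ω : ℕ∞ω)) := ⟨le_top⟩
  have hc : IsGeodesicallyComplete g.leviCivita :=
    g.isGeodesicallyComplete_of_compactSpace (le_top : (2 : ℕ∞ω) ≤ ω) hg
  obtain ⟨R₀, hR₀, hR⟩ := exists_edist_lt g hg p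
  refine (isBounded_setOf_val_lt g hg p hR₀).subset fun v hv => ?_
  obtain ⟨-, hmin, -⟩ := hv
  exact val_lt_sq_of_isMinimizingUpTo_one g hg hc p hR₀ hR hmin

/-- **`C(p) = exp_p(TCL(p))`** for a compact real-analytic Riemannian manifold, with `T_pM` read as
the model space `E` (Lee 2018, p. 310; the tree's `cutLocus_eq_geodesicCutLocus_of_compactSpace`).
[cite: LeeRiemannianManifolds2018, p. 310] -/
theorem cutLocus_eq_image_tangentCutLocus (hg : g.IsRiemannian) (p : M) :
    cutLocus g hg p = (fun v : E => expMap g.leviCivita p (show TangentSpace I p from v)) ''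
      {v : E | (show TangentSpace I p from v) ∈ tangentCutLocus g hg p} := by
  rw [cutLocus_eq_geodesicCutLocus_of_compactSpace (le_top : (∞ : ℕ∞ω) ≤ ω) hg p]
  rfl

end TangentCutLocus

/-! ## Buchner's theorem from Hironaka's image and triangulation theorems and Grauert–Morrey -/

section Reduction

universe u v w

/-- **Buchner's theorem from the three classical theorems of real-analytic geometry it rests on.**
Hypotheses, each a published theorem NOT in the tree, in the tree's vocabulary:
(P) **Hironaka's image theorem** (Hironaka 1975, §3, Proposition II, verbatim: "If `X ⊆ ℝᵐ` is
subanalytic and bounded and if `h : ℝᵐ → ℝⁿ` is a real-analytic map, then `h(X)` is subanalytic in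
`ℝⁿ`"; proved in Hironaka 1973): here with `IsSubanalytic`, `Bornology.IsBounded`,
`AnalyticOnNhd ℝ h univ`;
(G) **Grauert–Morrey 1958** (weak form): every compact connected Hausdorff boundaryless
real-analytic manifold admits an injective real-analytic map into some `ℝᴺ`;
(T) **Hironaka's triangulation theorem** (1975, §3): every compact subanalytic subset of `ℝᴺ` is
homeomorphic to the polyhedron of a finite simplicial complex.
Proof: `C(p) = exp_p(TCL(p))` with `TCL(p) ⊆ T_pM ≅ ℝⁿ` bounded subanalytic
(`isSubanalytic_tangentCutLocus`, from Def. 3.3 alone) and `ι ∘ exp_p` real-analytic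
(`contMDiff_riemannianExpMap_omega`), so `ι(C(p))` is subanalytic by (P); conclude by
`buchner1977_cutLocus_triangulable_of_subanalytic_image` (closedness of the cut locus, carrier and
dimension clause being theorems of the tree). [cite: Buchner1977Simplicial, pp. 118–121] -/
theorem buchner1977_cutLocus_triangulable_of_hironaka
    (hP : ∀ (m N : ℕ) (B : Set (Fin m → ℝ)) (f : (Fin m → ℝ) → (Fin N → ℝ)),
      IsSubanalytic B → Bornology.IsBounded B → AnalyticOnNhd ℝ f univ → IsSubanalytic (f '' B))
    (hG : ∀ {E : Type u} [NormedAddCommGroup E] [NormedSpace ℝ E] [FiniteDimensional ℝ E]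
      {H : Type v} [TopologicalSpace H] (I : ModelWithCorners ℝ E H) [I.Boundaryless]
      (M : Type w) [TopologicalSpace M] [ChartedSpace H M] [IsManifold I ω M]
      [CompactSpace M] [T2Space M] [ConnectedSpace M],
      ∃ (N : ℕ) (ι : M → (Fin N → ℝ)), ContMDiff I 𝓘(ℝ, Fin N → ℝ) ω ι ∧ Injective ι)
    (hT : ∀ (N : ℕ) (X : Set (Fin N → ℝ)), IsSubanalytic X → IsCompact X →
      ∃ (n : ℕ) (K : Geometry.SimplicialComplex ℝ (Fin n → ℝ)),
        K.faces.Finite ∧ Nonempty (X ≃ₜ K.space)) :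
    buchner1977_cutLocus_triangulable.{u, v, w} := by
  refine buchner1977_cutLocus_triangulable_of_subanalytic_image hT ?_
  intro E _ _ _ H _ I _ M _ _ _ _ _ _ g hg p
  haveI : CompleteSpace E := FiniteDimensional.complete ℝ E
  haveI : Fact (1 ≤ (ω : ℕ∞ω)) := ⟨le_top⟩
  haveI : g.HasLeviCivita := g.hasLeviCivita
  haveI : CovariantDerivative.ContMDiffCovariantDerivative g.leviCivita 1 :=
    ⟨g.isLocallyContMDiff_leviCivita_holds 1 le_top univ isOpen_univ⟩
  have hc : IsGeodesicallyComplete g.leviCivita :=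
    g.isGeodesicallyComplete_of_compactSpace (le_top : (2 : ℕ∞ω) ≤ ω) hg
  obtain ⟨N, ι, hι, hinj⟩ := hG I M
  refine ⟨N, ι, hι.continuous, hinj, ?_⟩
  -- `ι(C(p)) = (ι ∘ exp_p ∘ L⁻¹)(L(TCL(p)))` with `L : E ≅ ℝⁿ`
  set T : Set E := {v : E | (show TangentSpace I p from v) ∈ tangentCutLocus g hg p} with hTdef
  set n : ℕ := Module.finrank ℝ E with hn
  have hdim : Module.finrank ℝ E = Module.finrank ℝ (Fin n → ℝ) := by rw [Module.finrank_fin_fun]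
  set L : E ≃L[ℝ] (Fin n → ℝ) := ContinuousLinearEquiv.ofFinrankEq hdim with hL
  set f : (Fin n → ℝ) → (Fin N → ℝ) := fun y =>
    ι (expMap g.leviCivita p (show TangentSpace I p from L.symm y)) with hf
  have himg : ι '' cutLocus g hg p = f '' (L '' T) := by
    rw [cutLocus_eq_image_tangentCutLocus g hg p, image_image, image_image]
    refine image_congr fun v _ => ?_
    simp [hf]
  rw [himg]
  refine hP n N (L '' T) f ((isSubanalytic_tangentCutLocus g hg p).image_equiv L) ?_ ?_
  · exact (((isBounded_tangentCutLocus g hg p).isCompact_closure.image L.continuous).isBounded).subset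
      (image_mono subset_closure)
  · intro y _
    have h1 : ContMDiff 𝓘(ℝ, Fin n → ℝ) 𝓘(ℝ, Fin N → ℝ) ω f :=
      hι.comp ((contMDiff_riemannianExpMap_omega g hc p).comp
        (contMDiff_iff_contDiff.2 (L.symm : (Fin n → ℝ) →L[ℝ] E).contDiff))
    exact (contMDiff_iff_contDiff.1 h1).contDiffAt.analyticAt

/-- **Buchner's theorem from the two inputs as they appear in the paper** — the variant closest to
the printed text, which never leaves the analytic manifold `M`: (P_M) Buchner's Lemma (p. 120,
from Hironaka 1973: "if `A ⊂ X` is subanalytic and relatively compact and `f : X → M` is analytic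
then `f(A)` is subanalytic"; here `X = ℝᵐ`, `A` bounded, `f : ℝᵐ → M` real-analytic, subanalytic
in `M` meaning `IsManifoldSubanalytic`, Hironaka's Def. 3.3 on `M`), and (T_M) Hironaka's
triangulation theorem in the form Buchner applies it (p. 121: "the cut locus itself is subanalytic
and by [2] is triangulable"): a closed subanalytic subset of a compact real-analytic manifold is
homeomorphic to the polyhedron of a finite simplicial complex. Proof: `C(p) = exp_p(TCL(p))` is
subanalytic in `M` by (P_M) applied to the bounded subanalytic `TCL(p) ⊆ T_pM ≅ ℝⁿ`
(`isSubanalytic_tangentCutLocus`) and the analytic `exp_p`, closed (`isClosed_cutLocus_of_compactSpace`),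
hence triangulable by (T_M); carrier and dimension clause by
`buchner1977_cutLocus_triangulable_of_homeomorph_pi`. [cite: Buchner1977Simplicial, pp. 120–121] -/
theorem buchner1977_cutLocus_triangulable_of_manifold_hironaka
    (hP : ∀ {E : Type u} [NormedAddCommGroup E] [NormedSpace ℝ E] [FiniteDimensional ℝ E]
      {H : Type v} [TopologicalSpace H] (I : ModelWithCorners ℝ E H) [I.Boundaryless]
      {M : Type w} [TopologicalSpace M] [ChartedSpace H M] [IsManifold I ω M]
      [CompactSpace M] [T2Space M] [ConnectedSpace M]
      (m : ℕ) (B : Set (Fin m → ℝ)) (f : (Fin m → ℝ) → M),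
      IsSubanalytic B → Bornology.IsBounded B → ContMDiff 𝓘(ℝ, Fin m → ℝ) I ω f →
        IsManifoldSubanalytic I (f '' B))
    (hT : ∀ {E : Type u} [NormedAddCommGroup E] [NormedSpace ℝ E] [FiniteDimensional ℝ E]
      {H : Type v} [TopologicalSpace H] (I : ModelWithCorners ℝ E H) [I.Boundaryless]
      {M : Type w} [TopologicalSpace M] [ChartedSpace H M] [IsManifold I ω M]
      [CompactSpace M] [T2Space M] [ConnectedSpace M] (X : Set M),
      IsManifoldSubanalytic I X → IsClosed X →
        ∃ (n : ℕ) (K : Geometry.SimplicialComplex ℝ (Fin n → ℝ)),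
          K.faces.Finite ∧ Nonempty (X ≃ₜ K.space)) :
    buchner1977_cutLocus_triangulable.{u, v, w} := by
  refine buchner1977_cutLocus_triangulable_of_homeomorph_pi ?_
  intro E _ _ _ H _ I _ M _ _ _ _ _ _ g hg p
  haveI : CompleteSpace E := FiniteDimensional.complete ℝ E
  haveI : Fact (1 ≤ (ω : ℕ∞ω)) := ⟨le_top⟩
  haveI : g.HasLeviCivita := g.hasLeviCivita
  haveI : CovariantDerivative.ContMDiffCovariantDerivative g.leviCivita 1 :=
    ⟨g.isLocallyContMDiff_leviCivita_holds 1 le_top univ isOpen_univ⟩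
  have hc : IsGeodesicallyComplete g.leviCivita :=
    g.isGeodesicallyComplete_of_compactSpace (le_top : (2 : ℕ∞ω) ≤ ω) hg
  -- `C(p) = (exp_p ∘ L⁻¹)(L(TCL(p)))` with `L : E ≅ ℝⁿ`
  set T : Set E := {v : E | (show TangentSpace I p from v) ∈ tangentCutLocus g hg p} with hTdef
  set n : ℕ := Module.finrank ℝ E with hn
  have hdim : Module.finrank ℝ E = Module.finrank ℝ (Fin n → ℝ) := by rw [Module.finrank_fin_fun]
  set L : E ≃L[ℝ] (Fin n → ℝ) := ContinuousLinearEquiv.ofFinrankEq hdim with hL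
  set f : (Fin n → ℝ) → M := fun y =>
    expMap g.leviCivita p (show TangentSpace I p from L.symm y) with hf
  have himg : cutLocus g hg p = f '' (L '' T) := by
    rw [cutLocus_eq_image_tangentCutLocus g hg p, image_image]
    refine image_congr fun v _ => ?_
    simp [hf]
  have hsub : IsManifoldSubanalytic I (cutLocus g hg p) := by
    rw [himg]
    refine hP I n (L '' T) f ((isSubanalytic_tangentCutLocus g hg p).image_equiv L) ?_ ?_
    · exact (((isBounded_tangentCutLocus g hg p).isCompact_closure.image L.continuous).isBounded).subset
        (image_mono subset_closure)
    · exact (contMDiff_riemannianExpMap_omega g hc p).comp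
        (contMDiff_iff_contDiff.2 (L.symm : (Fin n → ℝ) →L[ℝ] E).contDiff)
  exact hT I (cutLocus g hg p) hsub (isClosed_cutLocus_of_compactSpace g le_top hg p)

end Reduction

end Literature.Geometry.Riemannian

end
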